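import Mathlib
import Summits.ResolutionOfSingularities.ResolutionOfSingularities.Theorems.WeightedInvariantLocalWeightedDropPureDescentShearBeta
import Summits.ResolutionOfSingularities.ResolutionOfSingularities.Theorems.WeightedInvariantLocalWeightedDropWildPurePowerDescentTwo
import Summits.ResolutionOfSingularities.ResolutionOfSingularities.Theorems.WeightedInvariantLocalWeightedDropWildPurePowerUnaryExit
import Summits.ResolutionOfSingularities.ResolutionOfSingularities.Theorems.WeightedInvariantGlobalizeLocalDropCylinder

/-!
# `WeightedInvariant.LocalWeightedDrop`, stub S3πM: the pure-power polyhedron descent — TOOLS OF THE GAME BRIDGE: scaled permutations of the plane, `y`-scaling absorbs units, the EXIT DISPATCH (piece P-B1)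

Crux item stmt-ResolutionOfSingularities-8899 `LocalWeightedDrop` (route `ResolutionOfSingularities/WeightedInvariant`), registered skeleton v29
(4058ce51dfd2e5c8), stub S3πM `stub_wildPurelyInseparableReductionWon`.  [OURS · L1 W4.3, chain w43, lead prover (gen 3); a LINE UNDER THE STUB: the
pure-power polyhedron descent (second key to S3πM), MODEL Cossart–Jannsen–Saito LNM 2270 Ch. 11–13 for `J = (y^q + A)`, `e = 2`, `k = k̄` — the
degree-2 instance is the landed key N4″ (`…Theorems.MonicDescent*`); nothing here is a statement of any manuscript.]

* `coeff_subst_diag` / `coeff_subst_swapDiag` — coefficients under `(u₁,u₂) ↦ (b₀u₁, b₁u₂)` / `(b₀u₂, b₁u₁)`; invertible linear parts; cleaning, positions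
  and vanishing are transported through `a · B'(Θ)` (`clean_C_mul_subst_*`, `isPosition_of_C_mul_subst_*`, `eq_zero_of_C_mul_subst_*_eq_zero`);
* `won_purePower_C_mul_iff` — over an algebraically closed field `y^q + a·D` is won iff `y^q + D` is (`a = α^q`, scale `y` by `α`; `won_subst_iff` +
  `won_unit_mul_iff`); `won_purePower_iff_clean` — a germ is won through the clean part of its coefficient (cleaning is a re-centring);
* `won_slice_of_transfer` — THE EXIT DISPATCH for a singular successor `y^q + T` tied to a label `B'`: `ord T < q` ⇒ (H<d); else `ord = q` and either
  the cone is WIDE (`…WildPurePowerUnaryExit.exists_recentre_of_wide`: re-centre to a position, clean, then `y^q` alone (`won_X_pow_last`) or the supplied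
  win of the cleaned label) or NOT wide (`won_of_order_eq_of_not_wide`: (H<d) + (Haxis)) — the pattern of stub-1's `purePower_won_of_descent₂` (p48xxxx).
-/

set_option linter.dupNamespace false -- mandated namespace of this single-conjunct summit

noncomputable section

namespace Summit.ResolutionOfSingularities.ResolutionOfSingularities.Theorems

namespace PureDescent

open MvPowerSeries MonicDescent Literature.RingTheory.TwoVariableSeries Literature.AlgebraicGeometry.Resolution
  Literature.AlgebraicGeometry.Resolution.CobordantGame WildPurePower WildTerminal

variable {k : Type} [Field k]

/-! ## Scaled permutations of the plane: the diagonal and the swapped diagonal -/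

/-- The diagonal family has zero constant terms. -/
theorem constantCoeff_diag (b₀ b₁ : k) (l : Fin 2) :
    constantCoeff ((fun l : Fin 2 => if l = 0 then C b₀ * X 0 else C b₁ * (X 1 : MvPowerSeries (Fin 2) k)) l) = 0 := by
  dsimp only
  split_ifs <;> rw [map_mul, constantCoeff_X, mul_zero]

/-- The swapped diagonal family has zero constant terms. -/
theorem constantCoeff_swapDiag (b₀ b₁ : k) (l : Fin 2) :
    constantCoeff ((fun l : Fin 2 => if l = 0 then C b₀ * X 1 else C b₁ * (X 0 : MvPowerSeries (Fin 2) k)) l) = 0 := by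
  dsimp only
  split_ifs <;> rw [map_mul, constantCoeff_X, mul_zero]

/-- The monomial `u₁^a u₂^b` as a product of powers. -/
theorem X_pow_mul_X_pow_eq_monomial (a b : ℕ) :
    (X 0 : MvPowerSeries (Fin 2) k) ^ a * X 1 ^ b = monomial (Finsupp.single 0 a + Finsupp.single 1 b) 1 := by
  rw [X_pow_eq, X_pow_eq, monomial_mul_monomial, one_mul]

/-- COEFFICIENTS UNDER THE DIAGONAL SCALING `(u₁,u₂) ↦ (b₀u₁, b₁u₂)`: `coeff d ↦ b₀^{d₀} b₁^{d₁} coeff d`. -/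
theorem coeff_subst_diag (b₀ b₁ : k) (G : MvPowerSeries (Fin 2) k) (d : Fin 2 →₀ ℕ) :
    coeff d (subst (fun l : Fin 2 => if l = 0 then C b₀ * X 0 else C b₁ * (X 1 : MvPowerSeries (Fin 2) k)) G) =
      b₀ ^ (d 0) * b₁ ^ (d 1) * coeff d G := by
  classical
  have hs := hasSubst_of_constantCoeff_zero (constantCoeff_diag b₀ b₁)
  have hprod : ∀ e : Fin 2 →₀ ℕ, (e.prod fun l m =>
      (fun l : Fin 2 => if l = 0 then C b₀ * X 0 else C b₁ * (X 1 : MvPowerSeries (Fin 2) k)) l ^ m) =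
      monomial e (b₀ ^ (e 0) * b₁ ^ (e 1)) := by
    intro e
    rw [Finsupp.prod_fintype _ _ (fun i => pow_zero _), Fin.prod_univ_two]
    simp only [if_true, show (1 : Fin 2) ≠ 0 from by decide, if_false]
    rw [mul_pow, mul_pow, ← map_pow, ← map_pow,
      show C (b₀ ^ e 0) * (X 0 : MvPowerSeries (Fin 2) k) ^ e 0 * (C (b₁ ^ e 1) * X 1 ^ e 1) =
        C (b₀ ^ e 0 * b₁ ^ e 1) * (X 0 ^ e 0 * X 1 ^ e 1) by rw [map_mul]; ring,
      X_pow_mul_X_pow_eq_monomial, ← monomial_zero_eq_C_apply, monomial_mul_monomial, zero_add, mul_one,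
      show (Finsupp.single 0 (e 0) + Finsupp.single 1 (e 1) : Fin 2 →₀ ℕ) = e from finsupp_fin2_ext (by simp) (by simp)]
  rw [coeff_subst hs G d, finsum_eq_single _ d]
  · rw [hprod, coeff_monomial_same, smul_eq_mul]
    ring
  · intro e he
    rw [hprod, coeff_monomial_ne (Ne.symm he), smul_zero]

/-- COEFFICIENTS UNDER THE SWAPPED SCALING `(u₁,u₂) ↦ (b₀u₂, b₁u₁)`: `coeff d ↦ b₀^{d₁} b₁^{d₀} coeff (d₁, d₀)`. -/
theorem coeff_subst_swapDiag (b₀ b₁ : k) (G : MvPowerSeries (Fin 2) k) (d : Fin 2 →₀ ℕ) :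
    coeff d (subst (fun l : Fin 2 => if l = 0 then C b₀ * X 1 else C b₁ * (X 0 : MvPowerSeries (Fin 2) k)) G) =
      b₀ ^ (d 1) * b₁ ^ (d 0) * coeff (Finsupp.single 0 (d 1) + Finsupp.single 1 (d 0)) G := by
  classical
  have hs := hasSubst_of_constantCoeff_zero (constantCoeff_swapDiag b₀ b₁)
  have hprod : ∀ e : Fin 2 →₀ ℕ, (e.prod fun l m =>
      (fun l : Fin 2 => if l = 0 then C b₀ * X 1 else C b₁ * (X 0 : MvPowerSeries (Fin 2) k)) l ^ m) =
      monomial (Finsupp.single 0 (e 1) + Finsupp.single 1 (e 0)) (b₀ ^ (e 0) * b₁ ^ (e 1)) := by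
    intro e
    rw [Finsupp.prod_fintype _ _ (fun i => pow_zero _), Fin.prod_univ_two]
    simp only [if_true, show (1 : Fin 2) ≠ 0 from by decide, if_false]
    rw [mul_pow, mul_pow, ← map_pow, ← map_pow,
      show C (b₀ ^ e 0) * (X 1 : MvPowerSeries (Fin 2) k) ^ e 0 * (C (b₁ ^ e 1) * X 0 ^ e 1) =
        C (b₀ ^ e 0 * b₁ ^ e 1) * (X 0 ^ e 1 * X 1 ^ e 0) by rw [map_mul]; ring,
      X_pow_mul_X_pow_eq_monomial, ← monomial_zero_eq_C_apply, monomial_mul_monomial, zero_add, mul_one]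
  rw [coeff_subst hs G d, finsum_eq_single _ (Finsupp.single 0 (d 1) + Finsupp.single 1 (d 0))]
  · rw [hprod]
    have hidx : Finsupp.single 0 ((Finsupp.single 0 (d 1) + Finsupp.single 1 (d 0) : Fin 2 →₀ ℕ) 1) +
        Finsupp.single 1 ((Finsupp.single 0 (d 1) + Finsupp.single 1 (d 0) : Fin 2 →₀ ℕ) 0) = d :=
      finsupp_fin2_ext (by simp) (by simp)
    rw [hidx, coeff_monomial_same, smul_eq_mul]
    simp only [Finsupp.add_apply, Finsupp.single_eq_same, Finsupp.single_eq_of_ne (show (0 : Fin 2) ≠ 1 by decide),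
      Finsupp.single_eq_of_ne (show (1 : Fin 2) ≠ 0 by decide), add_zero, zero_add]
    ring
  · intro e he
    rw [hprod, coeff_monomial_ne, smul_zero]
    intro hde
    apply he
    have h0 := congrArg (fun P => P 0) hde
    have h1 := congrArg (fun P => P 1) hde
    simp only [Finsupp.add_apply, Finsupp.single_eq_same, Finsupp.single_eq_of_ne (show (0 : Fin 2) ≠ 1 by decide),
      Finsupp.single_eq_of_ne (show (1 : Fin 2) ≠ 0 by decide), add_zero, zero_add] at h0 h1
    exact finsupp_fin2_ext (by simp [← h1]) (by simp [← h0])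

/-- The diagonal scaling has an invertible linear part (`b₀ b₁ ≠ 0`). -/
theorem isUnit_det_diag {b₀ b₁ : k} (hb₀ : b₀ ≠ 0) (hb₁ : b₁ ≠ 0) :
    IsUnit (FormalCoordChange.linMat (fun l : Fin 2 => if l = 0 then C b₀ * X 0 else C b₁ * (X 1 : MvPowerSeries (Fin 2) k))).det := by
  rw [Matrix.det_fin_two]
  simp [FormalCoordChange.linMat, coeff_X, coeff_C_mul, Finsupp.single_eq_single_iff, hb₀, hb₁]

/-- The swapped scaling has an invertible linear part. -/
theorem isUnit_det_swapDiag {b₀ b₁ : k} (hb₀ : b₀ ≠ 0) (hb₁ : b₁ ≠ 0) :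
    IsUnit (FormalCoordChange.linMat (fun l : Fin 2 => if l = 0 then C b₀ * X 1 else C b₁ * (X 0 : MvPowerSeries (Fin 2) k))).det := by
  rw [Matrix.det_fin_two]
  simp [FormalCoordChange.linMat, coeff_X, coeff_C_mul, Finsupp.single_eq_single_iff, hb₀, hb₁]

/-! ## Cleaning, positions and vanishing are transported by the two scalings -/

/-- The swap of an exponent. -/
theorem forall_dvd_swap_iff (q : ℕ) (d : Fin 2 →₀ ℕ) :
    (∀ i, q ∣ (Finsupp.single 0 (d 1) + Finsupp.single 1 (d 0) : Fin 2 →₀ ℕ) i) ↔ ∀ i, q ∣ d i := by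
  constructor
  · intro h i
    fin_cases i
    · simpa using h 1
    · simpa using h 0
  · intro h i
    fin_cases i
    · simpa using h 1
    · simpa using h 0

/-- Cleaning commutes with `C a · diag`. -/
theorem clean_C_mul_subst_diag (q : ℕ) (a b₀ b₁ : k) (G : MvPowerSeries (Fin 2) k) :
    clean q (C a * subst (fun l : Fin 2 => if l = 0 then C b₀ * X 0 else C b₁ * (X 1 : MvPowerSeries (Fin 2) k)) G) =
      C a * subst (fun l : Fin 2 => if l = 0 then C b₀ * X 0 else C b₁ * (X 1 : MvPowerSeries (Fin 2) k)) (clean q G) := by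
  ext d
  rw [coeff_clean, coeff_C_mul, coeff_C_mul, coeff_subst_diag, coeff_subst_diag, coeff_clean]
  split_ifs <;> ring

/-- Cleaning commutes with `C a · swapDiag` (the lattice is symmetric). -/
theorem clean_C_mul_subst_swapDiag (q : ℕ) (a b₀ b₁ : k) (G : MvPowerSeries (Fin 2) k) :
    clean q (C a * subst (fun l : Fin 2 => if l = 0 then C b₀ * X 1 else C b₁ * (X 0 : MvPowerSeries (Fin 2) k)) G) =
      C a * subst (fun l : Fin 2 => if l = 0 then C b₀ * X 1 else C b₁ * (X 0 : MvPowerSeries (Fin 2) k)) (clean q G) := by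
  ext d
  rw [coeff_clean, coeff_C_mul, coeff_C_mul, coeff_subst_swapDiag, coeff_subst_swapDiag, coeff_clean]
  by_cases hd : ∀ i, q ∣ d i
  · rw [if_pos hd, if_pos ((forall_dvd_swap_iff q d).mpr hd), mul_zero, mul_zero]
  · rw [if_neg hd, if_neg (fun h => hd ((forall_dvd_swap_iff q d).mp h))]

/-- Vanishing is transported by `C a · diag` (units). -/
theorem eq_zero_of_C_mul_subst_diag_eq_zero {a b₀ b₁ : k} (ha : a ≠ 0) (hb₀ : b₀ ≠ 0) (hb₁ : b₁ ≠ 0)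
    {G : MvPowerSeries (Fin 2) k}
    (h : C a * subst (fun l : Fin 2 => if l = 0 then C b₀ * X 0 else C b₁ * (X 1 : MvPowerSeries (Fin 2) k)) G = 0) : G = 0 := by
  ext d
  have hd := congrArg (coeff d) h
  rw [coeff_C_mul, coeff_subst_diag, MvPowerSeries.coeff_zero] at hd
  rw [MvPowerSeries.coeff_zero]
  simpa [ha, hb₀, hb₁] using hd

/-- Vanishing is transported by `C a · swapDiag` (units). -/
theorem eq_zero_of_C_mul_subst_swapDiag_eq_zero {a b₀ b₁ : k} (ha : a ≠ 0) (hb₀ : b₀ ≠ 0) (hb₁ : b₁ ≠ 0)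
    {G : MvPowerSeries (Fin 2) k}
    (h : C a * subst (fun l : Fin 2 => if l = 0 then C b₀ * X 1 else C b₁ * (X 0 : MvPowerSeries (Fin 2) k)) G = 0) : G = 0 := by
  ext d
  have hd := congrArg (coeff (Finsupp.single 0 (d 1) + Finsupp.single 1 (d 0))) h
  rw [coeff_C_mul, coeff_subst_swapDiag, MvPowerSeries.coeff_zero] at hd
  have hidx : (Finsupp.single 0 ((Finsupp.single 0 (d 1) + Finsupp.single 1 (d 0) : Fin 2 →₀ ℕ) 1) +
      Finsupp.single 1 ((Finsupp.single 0 (d 1) + Finsupp.single 1 (d 0) : Fin 2 →₀ ℕ) 0) : Fin 2 →₀ ℕ) = d :=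
    finsupp_fin2_ext (by simp) (by simp)
  rw [hidx] at hd
  rw [MvPowerSeries.coeff_zero]
  simpa [ha, hb₀, hb₁] using hd

/-- Positions are transported BACK through `C a · diag` (units): the supports coincide. -/
theorem isPosition_of_C_mul_subst_diag {q : ℕ} {a b₀ b₁ : k} (ha : a ≠ 0) (hb₀ : b₀ ≠ 0) (hb₁ : b₁ ≠ 0)
    {G : MvPowerSeries (Fin 2) k}
    (h : IsPosition q (C a * subst (fun l : Fin 2 => if l = 0 then C b₀ * X 0 else C b₁ * (X 1 : MvPowerSeries (Fin 2) k)) G)) :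
    IsPosition q G := by
  apply isPosition_of_succ_le_sum
  intro P hP
  refine succ_le_sum_of_isPosition h P ?_
  rw [mem_nset_iff, coeff_C_mul, coeff_subst_diag]
  rw [mem_nset_iff] at hP
  simp [ha, hb₀, hb₁, hP]

/-- Positions are transported BACK through `C a · swapDiag` (units): the supports are swapped. -/
theorem isPosition_of_C_mul_subst_swapDiag {q : ℕ} {a b₀ b₁ : k} (ha : a ≠ 0) (hb₀ : b₀ ≠ 0) (hb₁ : b₁ ≠ 0)
    {G : MvPowerSeries (Fin 2) k}
    (h : IsPosition q (C a * subst (fun l : Fin 2 => if l = 0 then C b₀ * X 1 else C b₁ * (X 0 : MvPowerSeries (Fin 2) k)) G)) :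
    IsPosition q G := by
  apply isPosition_of_succ_le_sum
  intro P hP
  have hmem : (Finsupp.single 0 (P 1) + Finsupp.single 1 (P 0) : Fin 2 →₀ ℕ) ∈
      nset (C a * subst (fun l : Fin 2 => if l = 0 then C b₀ * X 1 else C b₁ * (X 0 : MvPowerSeries (Fin 2) k)) G) := by
    rw [mem_nset_iff, coeff_C_mul, coeff_subst_swapDiag]
    rw [mem_nset_iff] at hP
    have hidx : (Finsupp.single 0 (P 0) + Finsupp.single 1 (P 1) : Fin 2 →₀ ℕ) = P := finsupp_fin2_ext (by simp) (by simp)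
    simp only [Finsupp.add_apply, Finsupp.single_eq_same, Finsupp.single_eq_of_ne (show (0 : Fin 2) ≠ 1 by decide),
      Finsupp.single_eq_of_ne (show (1 : Fin 2) ≠ 0 by decide), add_zero, zero_add, hidx]
    simp [ha, hb₀, hb₁, hP]
  have hle := succ_le_sum_of_isPosition h _ hmem
  simp only [Finsupp.add_apply, Finsupp.single_eq_same, Finsupp.single_eq_of_ne (show (0 : Fin 2) ≠ 1 by decide),
    Finsupp.single_eq_of_ne (show (1 : Fin 2) ≠ 0 by decide), add_zero, zero_add] at hle
  omega

/-! ## Won-invariance: units on the coefficient series and plane changes -/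

/-- SCALING `y` ABSORBS A UNIT ON THE COEFFICIENT (`k` algebraically closed, so `a = α^q`): `y^q + a·D` is won iff `y^q + D` is. -/
theorem won_purePower_C_mul_iff [IsAlgClosed k] {q : ℕ} (hq : 0 < q) {a : k} (ha : a ≠ 0) (D : MvPowerSeries (Fin 2) k) :
    CobordantGame.Won k (2 + 1) ((X (Fin.last 2) : MvPowerSeries (Fin (2 + 1)) k) ^ q +
        rename (Fin.succAboveEmb (Fin.last 2)) (C a * D)) ↔
      CobordantGame.Won k (2 + 1) ((X (Fin.last 2) : MvPowerSeries (Fin (2 + 1)) k) ^ q +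
        rename (Fin.succAboveEmb (Fin.last 2)) D) := by
  classical
  obtain ⟨α, hα⟩ := IsAlgClosed.exists_pow_nat_eq a hq
  have hα0 : α ≠ 0 := by rintro rfl; rw [zero_pow hq.ne'] at hα; exact ha hα.symm
  set θ : Fin (2 + 1) → MvPowerSeries (Fin (2 + 1)) k := fun l => if l = Fin.last 2 then C α * X (Fin.last 2) else X l with hθ
  have hθ0 : ∀ l, constantCoeff (θ l) = 0 := by
    intro l; simp only [hθ]; split_ifs
    · rw [map_mul, constantCoeff_X, mul_zero]
    · exact constantCoeff_X l
  have hs := hasSubst_of_constantCoeff_zero hθ0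
  have hlin : FormalCoordChange.linMat θ = Matrix.diagonal fun i : Fin (2 + 1) => if i = Fin.last 2 then α else 1 := by
    ext i j
    rw [FormalCoordChange.linMat, Matrix.of_apply, Matrix.diagonal_apply]
    simp only [hθ]
    by_cases hi : i = Fin.last 2
    · rw [if_pos hi, coeff_C_mul, coeff_X]
      by_cases hij : i = j
      · subst hij; rw [if_pos (by rw [hi]), if_pos rfl, if_pos hi, mul_one]
      · rw [if_neg (fun h => hij (hi.trans ((Finsupp.single_left_inj one_ne_zero).mp h).symm)), if_neg hij, mul_zero]
    · rw [if_neg hi, coeff_X]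
      by_cases hij : i = j
      · subst hij; rw [if_pos rfl, if_pos rfl, if_neg hi]
      · rw [if_neg (fun h => hij ((Finsupp.single_left_inj one_ne_zero).mp h).symm), if_neg hij]
  have hdet : IsUnit (FormalCoordChange.linMat θ).det := by
    rw [hlin, Matrix.det_diagonal]
    refine isUnit_iff_ne_zero.mpr (Finset.prod_ne_zero_iff.mpr fun i _ => ?_)
    split_ifs
    · exact hα0
    · exact one_ne_zero
  have hθlast : subst θ (X (Fin.last 2) : MvPowerSeries (Fin (2 + 1)) k) = C α * X (Fin.last 2) := by
    rw [subst_X hs]; simp only [hθ, if_true]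
  have hθren : ∀ G : MvPowerSeries (Fin 2) k, subst θ (rename (Fin.succAboveEmb (Fin.last 2)) G) = rename (Fin.succAboveEmb (Fin.last 2)) G := by
    intro G
    rw [subst_rename_eq _ _ hθ0, rename_eq_subst]
    congr 1
    funext i
    simp only [hθ, Function.comp_apply, Fin.coe_succAboveEmb, Fin.succAbove_last]
    rw [if_neg (Fin.castSucc_lt_last i).ne]
  have hkey : subst θ ((X (Fin.last 2) : MvPowerSeries (Fin (2 + 1)) k) ^ q + rename (Fin.succAboveEmb (Fin.last 2)) (C a * D)) =
      C a * ((X (Fin.last 2) : MvPowerSeries (Fin (2 + 1)) k) ^ q + rename (Fin.succAboveEmb (Fin.last 2)) D) := by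
    rw [← coe_substAlgHom hs, map_add, map_pow, coe_substAlgHom, hθlast, hθren, map_mul, rename_C, mul_pow, ← map_pow, hα]
    ring
  have hCa : constantCoeff (C a : MvPowerSeries (Fin (2 + 1)) k) ≠ 0 := by rwa [constantCoeff_C]
  rw [← won_subst_iff hθ0 hdet, hkey, won_unit_mul_iff hCa]

/-! ## The generic exit dispatch for a singular successor `y^q + T` represented by a label `B'` -/

/-- A series is won through its clean part (perfect field): `y^q + X` is won iff `y^q + clean X` is (`X(0) = 0`). -/
theorem won_purePower_iff_clean (p : ℕ) (hp : p.Prime) [CharP k p] [PerfectRing k p] (e : ℕ) (X₀ : MvPowerSeries (Fin 2) k)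
    (hX : constantCoeff X₀ = 0) :
    CobordantGame.Won k (2 + 1) ((X (Fin.last 2) : MvPowerSeries (Fin (2 + 1)) k) ^ (p ^ e) +
        rename (Fin.succAboveEmb (Fin.last 2)) X₀) ↔
      CobordantGame.Won k (2 + 1) ((X (Fin.last 2) : MvPowerSeries (Fin (2 + 1)) k) ^ (p ^ e) +
        rename (Fin.succAboveEmb (Fin.last 2)) (clean (p ^ e) X₀)) := by
  obtain ⟨ψ, hψ0, hcl⟩ := exists_clean_eq_add_pow p hp e X₀ hX
  rw [hcl]
  exact (won_purePower_recentre_iff p hp e ψ hψ0 X₀).symm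

/-- THE EXIT DISPATCH (the heart of the game bridge; `q = p^e`, `k` algebraically closed of characteristic `p`).  Let `S = y^q + T` be a SINGULAR
successor whose coefficient `T` is tied to a LABEL `B'` by three transfers (won-transfer from `clean B'` to `clean T`, position back-transfer,
zero-transfer — supplied by a scaled permutation `T = a · B'(Θ)`).  If the cleaned label — when it is a non-zero position — gives a won germ, then
`S` is won: (i) `ord T < q` ⇒ `ord S < q` ⇒ hypothesis (H<d); (ii) else `ord S = q`; if the cone of `S` is WIDE, a linear re-centring makes `T` a
position (`exists_recentre_of_wide`), cleaning is free, and the cleaned label is `0` (then `S ~ y^q`, won in one move) or a smaller clean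
position (the supplied win); if the cone is NOT wide, the apex has dimension `≤ 1` ⇒ `won_of_order_eq_of_not_wide` ((H<d) + (Haxis)). -/
theorem won_slice_of_transfer (p : ℕ) (hp : p.Prime) (k : Type) [Field k] [CharP k p] [IsAlgClosed k] (e : ℕ)
    (hord : ∀ g : MvPowerSeries (Fin 3) k, CobordantGame.IsSingular k g → g.order < (p ^ e : ℕ) → CobordantGame.Won k 3 g)
    (haxis : ∀ g : MvPowerSeries (Fin 3) k, CobordantGame.IsSingular k g → g.order = (p ^ e : ℕ) →
      (∃ c : Fin 3 → k, c ≠ 0 ∧ ∀ v : Fin 3 → k,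
        CobordantChart.initEval (fun _ : Fin 3 => 1) (v + c) (p ^ e) g = CobordantChart.initEval (fun _ : Fin 3 => 1) v (p ^ e) g) →
      (∀ c₁ c₂ : Fin 3 → k,
        (∀ v : Fin 3 → k, CobordantChart.initEval (fun _ : Fin 3 => 1) (v + c₁) (p ^ e) g =
          CobordantChart.initEval (fun _ : Fin 3 => 1) v (p ^ e) g) →
        (∀ v : Fin 3 → k, CobordantChart.initEval (fun _ : Fin 3 => 1) (v + c₂) (p ^ e) g =
          CobordantChart.initEval (fun _ : Fin 3 => 1) v (p ^ e) g) →
        ∃ α β : k, (α ≠ 0 ∨ β ≠ 0) ∧ α • c₁ + β • c₂ = 0) →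
      CobordantGame.Won k 3 g)
    (T B' : MvPowerSeries (Fin 2) k)
    (hwon : CobordantGame.Won k (2 + 1) ((X (Fin.last 2) : MvPowerSeries (Fin (2 + 1)) k) ^ (p ^ e) +
        rename (Fin.succAboveEmb (Fin.last 2)) (clean (p ^ e) B')) →
      CobordantGame.Won k (2 + 1) ((X (Fin.last 2) : MvPowerSeries (Fin (2 + 1)) k) ^ (p ^ e) +
        rename (Fin.succAboveEmb (Fin.last 2)) (clean (p ^ e) T)))
    (hposT : IsPosition (p ^ e) (clean (p ^ e) T) → IsPosition (p ^ e) (clean (p ^ e) B'))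
    (hzero : clean (p ^ e) B' = 0 → clean (p ^ e) T = 0)
    (IH : IsPosition (p ^ e) (clean (p ^ e) B') → clean (p ^ e) B' ≠ 0 →
      CobordantGame.Won k (2 + 1) ((X (Fin.last 2) : MvPowerSeries (Fin (2 + 1)) k) ^ (p ^ e) +
        rename (Fin.succAboveEmb (Fin.last 2)) (clean (p ^ e) B')))
    (hsing : CobordantGame.IsSingular k ((X (Fin.last 2) : MvPowerSeries (Fin (2 + 1)) k) ^ (p ^ e) +
      rename (Fin.succAboveEmb (Fin.last 2)) T)) :
    CobordantGame.Won k (2 + 1) ((X (Fin.last 2) : MvPowerSeries (Fin (2 + 1)) k) ^ (p ^ e) +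
      rename (Fin.succAboveEmb (Fin.last 2)) T) := by
  classical
  haveI := Fact.mk hp
  haveI : PerfectRing k p := IsAlgClosed.perfectRing k p
  set q := p ^ e with hq
  have hq0 : 0 < q := pow_pos hp.pos e
  by_cases hTlt : T.order < (q : ℕ)
  · exact hord _ hsing (lt_of_le_of_lt (order_X_pow_add_rename_le hq0 T) hTlt)
  rw [not_lt] at hTlt
  have hSq : ((X (Fin.last 2) : MvPowerSeries (Fin (2 + 1)) k) ^ q + rename (Fin.succAboveEmb (Fin.last 2)) T).order = q :=
    order_X_pow_add_rename_eq hq0 T hTlt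
  by_cases hwide : ∃ c₁ c₂ : Fin 3 → k, (∀ α β : k, α • c₁ + β • c₂ = 0 → α = 0 ∧ β = 0) ∧
      (∀ v : Fin 3 → k, CobordantChart.initEval (fun _ : Fin 3 => 1) (v + c₁) q
        ((X (Fin.last 2) : MvPowerSeries (Fin (2 + 1)) k) ^ q + rename (Fin.succAboveEmb (Fin.last 2)) T) =
        CobordantChart.initEval (fun _ : Fin 3 => 1) v q
        ((X (Fin.last 2) : MvPowerSeries (Fin (2 + 1)) k) ^ q + rename (Fin.succAboveEmb (Fin.last 2)) T)) ∧
      (∀ v : Fin 3 → k, CobordantChart.initEval (fun _ : Fin 3 => 1) (v + c₂) q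
        ((X (Fin.last 2) : MvPowerSeries (Fin (2 + 1)) k) ^ q + rename (Fin.succAboveEmb (Fin.last 2)) T) =
        CobordantChart.initEval (fun _ : Fin 3 => 1) v q
        ((X (Fin.last 2) : MvPowerSeries (Fin (2 + 1)) k) ^ q + rename (Fin.succAboveEmb (Fin.last 2)) T))
  · -- wide apex: a linear re-centring makes `T` a position; clean it; the cleaned label is `0` or smaller
    obtain ⟨c₁, c₂, hind, h₁, h₂⟩ := hwide
    obtain ⟨φ', hφ'0, hφ'ord, hiff⟩ := exists_recentre_of_wide p hp k e T hTlt c₁ c₂ hind h₁ h₂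
    rw [hiff]
    have hT0 : constantCoeff (T + φ' ^ q) = 0 := by
      have h0 : coeff (0 : Fin 2 →₀ ℕ) (T + φ' ^ q) = 0 := coeff_of_lt_order (lt_of_le_of_lt (by simp) hφ'ord)
      simpa using h0
    rw [won_purePower_iff_clean p hp e (T + φ' ^ q) hT0, clean_add_pow p hp e T φ']
    have hposT' : IsPosition q (clean q T) := by
      rw [← clean_add_pow p hp e T φ']; exact isPosition_clean hφ'ord
    by_cases h0 : clean q B' = 0
    · rw [hzero h0, map_zero, add_zero]
      exact won_X_pow_last 2 q
    · exact hwon (IH (hposT hposT') h0)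
  · exact won_of_order_eq_of_not_wide p hp k hord haxis _ hsing hSq hwide

end PureDescent

end Summit.ResolutionOfSingularities.ResolutionOfSingularities.Theorems

end
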